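import Literature.NumberTheory.LFunctions.DedekindZetaHalfPlane
import Mathlib.Analysis.MellinTransform
import Mathlib.NumberTheory.LSeries.SumCoeff
import HarnessLib

/-!
# Landau's continuation of `ζ_K` to `σ > 1 − 1/d` from the ideal-counting error term (proof)

Topic `Literature/NumberTheory/LFunctions` (sibling of `DedekindZetaHalfPlane.lean`). This file
PROVES the implication between two named facts of that file:

`idealCount_sub_residue_mul_le K → exists_isLandauContinuation K`,

i.e. Landau's property 1) (1903, p. 666) / Montgomery–Vaughan p. 267: from
`I_K(x) = ρ_K x + O(x^{1−1/d})` one gets, by partial summation (MV Theorem 1.3, Mathlib's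
`LSeries_eq_mul_integral'`),
`ζ_K(s) = s ∫₁^∞ I_K(t) t^{−s−1} dt = ρ_K s/(s − 1) + s ∫₁^∞ (I_K(t) − ρ_K t) t^{−s−1} dt`,
where the last integral — a Mellin transform — is holomorphic for `σ > 1 − 1/d` (Mathlib's
`mellin_differentiableAt_of_isBigO_rpow`) and bounded by `C/(σ − 1 + 1/d)`.

## Content (namespace `Literature.NumberField`)

* `idealCountError K t = I_K(t) − ρ_K t`, `idealCountErrorC K` (its extension by `0` to `t ≤ 1`,
  complex-valued), `landauG K s = ρ_K s + s (s − 1) · 𝓜(idealCountErrorC K)(−s)`.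
* `landauG_one`, `landauG_eq_mul` (`= (s − 1) ζ_K(s)` for `σ > 1`), `differentiableOn_landauG`,
  `norm_landauG_div_le` (growth `≪_δ |t|`), all under the hypothesis
  `idealCount_sub_residue_mul_le K` where needed.
* `exists_isLandauContinuation_of_idealCount` — the implication.

## References

* E. Landau, *Neuer Beweis des Primzahlsatzes und Beweis des Primidealsatzes*, Math. Ann. 56
  (1903), 645–670, Part II §9, p. 666 (`LandauMathAnn1903`).
* H. L. Montgomery, R. C. Vaughan, *Multiplicative Number Theory I. Classical Theory*,
  Cambridge Stud. Adv. Math. 97 (2007), p. 267 and Theorem 1.3 (`MontgomeryVaughan2007`).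
-/

noncomputable section

open Complex Filter Set Topology Finset MeasureTheory Asymptotics
open scoped NumberField nonZeroDivisors

namespace Literature.NumberTheory.LFunctions.NumberField

variable (K : Type*) [Field K] [NumberField K]

/-! ### The error term and its basic properties -/

/-- `I_K` is monotone. [folklore] -/
theorem idealCount_mono : Monotone (idealCount K) := by
  intro x y hxy
  have hfin : Set.Finite
      {I : (Ideal (𝓞 K))⁰ | (Ideal.absNorm (I : Ideal (𝓞 K)) : ℝ) ≤ y} := by
    refine (Ideal.finite_setOf_absNorm_le₀ (S := 𝓞 K) ⌊|y|⌋₊).subset ?_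
    intro I hI
    simp only [Set.mem_setOf_eq] at hI ⊢
    refine Nat.le_floor ?_
    exact hI.trans (le_abs_self y)
  exact Nat.card_mono hfin fun I (hI : (Ideal.absNorm (I : Ideal (𝓞 K)) : ℝ) ≤ x) ↦ hI.trans hxy

/-- `t ↦ I_K(t)` is measurable (it is monotone). [folklore] -/
theorem measurable_idealCount : Measurable fun t : ℝ ↦ (idealCount K t : ℝ) :=
  Monotone.measurable fun _ _ h ↦ Nat.cast_le.mpr (idealCount_mono K h)

/-- The error term `E_K(t) = I_K(t) − ρ_K t` in the ideal count (MV (8.43)).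
[cite: MontgomeryVaughan2007, (8.43) p. 266] -/
def idealCountError (t : ℝ) : ℝ :=
  (idealCount K t : ℝ) - NumberField.dedekindZeta_residue K * t

/-- `E_K` extended by `0` on `t ≤ 1`, as a complex-valued function on `ℝ` (the function whose
Mellin transform at `−s` is `∫₁^∞ E_K(t) t^{−s−1} dt`). [folklore] -/
def idealCountErrorC : ℝ → ℂ :=
  (Set.Ioi (1 : ℝ)).indicator fun t ↦ (idealCountError K t : ℂ)

/-- `E_K` is measurable. [folklore] -/
theorem measurable_idealCountError : Measurable (idealCountError K) :=
  (measurable_idealCount K).sub (measurable_const.mul measurable_id)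

/-- `idealCountErrorC K` is measurable. [folklore] -/
theorem measurable_idealCountErrorC : Measurable (idealCountErrorC K) :=
  (Complex.measurable_ofReal.comp (measurable_idealCountError K)).indicator measurableSet_Ioi

/-- `|E_K(t)| ≤ I_K(b) + ρ_K |b|` for `0 ≤ t ≤ b` … in the crude form `≤ I_K(b) + ρ_K (|a| + |b|)`
on `[a, b]`. [folklore] -/
theorem abs_idealCountError_le {a b t : ℝ} (ht : t ∈ Set.Icc a b) :
    |idealCountError K t| ≤ idealCount K b + NumberField.dedekindZeta_residue K * (|a| + |b|) := by
  have hρ := (NumberField.dedekindZeta_residue_pos K).le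
  have h1 : (idealCount K t : ℝ) ≤ idealCount K b := Nat.cast_le.mpr (idealCount_mono K ht.2)
  have h2 : |t| ≤ |a| + |b| := by
    rcases le_total 0 t with h | h
    · rw [abs_of_nonneg h]; linarith [le_abs_self b, ht.2, abs_nonneg a]
    · rw [abs_of_nonpos h]; linarith [neg_abs_le a, ht.1, abs_nonneg b]
  rw [idealCountError, abs_le]
  constructor
  · have : NumberField.dedekindZeta_residue K * t ≤
        NumberField.dedekindZeta_residue K * (|a| + |b|) :=
      mul_le_mul_of_nonneg_left ((le_abs_self t).trans h2) hρ
    have h0 : (0 : ℝ) ≤ idealCount K t := Nat.cast_nonneg _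
    linarith
  · have : -(NumberField.dedekindZeta_residue K * t) ≤
        NumberField.dedekindZeta_residue K * (|a| + |b|) := by
      have := mul_le_mul_of_nonneg_left ((neg_le_abs t).trans h2) hρ
      linarith
    linarith

/-- `idealCountErrorC K` is locally integrable (bounded on bounded sets and measurable).
[folklore] -/
theorem locallyIntegrable_idealCountErrorC : LocallyIntegrable (idealCountErrorC K) := by
  rw [MeasureTheory.locallyIntegrable_iff]
  intro k hk
  rcases k.eq_empty_or_nonempty with rfl | hne
  · exact integrableOn_empty
  obtain ⟨a, ha⟩ := hk.bddBelow
  obtain ⟨b, hb⟩ := hk.bddAbove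
  have hsub : k ⊆ Set.Icc a b := fun x hx ↦ ⟨ha hx, hb hx⟩
  refine IntegrableOn.mono_set ?_ hsub
  refine Measure.integrableOn_of_bounded (M := idealCount K b +
      NumberField.dedekindZeta_residue K * (|a| + |b|)) (by simp)
    (measurable_idealCountErrorC K).aestronglyMeasurable ?_
  refine ae_restrict_of_forall_mem measurableSet_Icc fun t ht ↦ ?_
  unfold idealCountErrorC
  rcases em (t ∈ Set.Ioi (1 : ℝ)) with h | h
  · rw [Set.indicator_of_mem h, Complex.norm_real, Real.norm_eq_abs]
    exact abs_idealCountError_le K ht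
  · rw [Set.indicator_of_notMem h, norm_zero]
    have := (NumberField.dedekindZeta_residue_pos K).le
    positivity

/-- Near `0⁺` the function `idealCountErrorC K` vanishes, so it is `O(t^{−b})` for every `b`.
[folklore] -/
theorem isBigO_idealCountErrorC_nhdsGT_zero (b : ℝ) :
    idealCountErrorC K =O[𝓝[>] 0] fun t : ℝ ↦ t ^ (-b) := by
  refine IsBigO.of_bound 0 ?_
  filter_upwards [Ioo_mem_nhdsGT (zero_lt_one' ℝ)] with t ht
  have : t ∉ Set.Ioi (1 : ℝ) := fun h ↦ (lt_irrefl _ (ht.2.trans h))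
  simp [idealCountErrorC, Set.indicator_of_notMem this]

/-- The Mellin transform of `idealCountErrorC K` is the integral `∫₁^∞ t^{z−1} E_K(t) dt`.
[folklore] -/
theorem mellin_idealCountErrorC (z : ℂ) :
    mellin (idealCountErrorC K) z =
      ∫ t in Set.Ioi (1 : ℝ), (t : ℂ) ^ (z - 1) * (idealCountError K t : ℂ) := by
  simp only [mellin, smul_eq_mul, idealCountErrorC]
  have : (fun t : ℝ ↦ (t : ℂ) ^ (z - 1) *
      (Set.Ioi (1 : ℝ)).indicator (fun t ↦ (idealCountError K t : ℂ)) t) =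
      (Set.Ioi (1 : ℝ)).indicator fun t ↦ (t : ℂ) ^ (z - 1) * (idealCountError K t : ℂ) :=
    funext fun t ↦ (Set.indicator_mul_right (Set.Ioi (1 : ℝ)) (fun u : ℝ ↦ (u : ℂ) ^ (z - 1))
      (fun u ↦ (idealCountError K u : ℂ))).symm
  rw [this, setIntegral_indicator measurableSet_Ioi,
    Set.inter_eq_right.mpr (Set.Ioi_subset_Ioi zero_le_one)]

/-! ### Landau's function `G` -/

/-- Landau's `G(s) = ρ_K s + s (s − 1) ∫₁^∞ E_K(t) t^{−s−1} dt`, the candidate for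
`(s − 1) ζ_K(s)` on `σ > 1 − 1/d` (MV p. 267, multiplied by `s − 1`). The integral is written as
the Mellin transform of `idealCountErrorC K` at `−s`. [cite: MontgomeryVaughan2007, p. 267] -/
def landauG (s : ℂ) : ℂ :=
  (NumberField.dedekindZeta_residue K : ℂ) * s +
    s * (s - 1) * mellin (idealCountErrorC K) (-s)

/-- `G(1) = ρ_K`. [folklore] -/
theorem landauG_one : landauG K 1 = (NumberField.dedekindZeta_residue K : ℂ) := by
  simp [landauG]

variable {K} in
/-- The constant of `idealCount_sub_residue_mul_le` is nonnegative and bounds `E_K`. [folklore] -/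
theorem exists_bound_idealCountError (h : idealCount_sub_residue_mul_le K) :
    ∃ C₀ : ℝ, 0 ≤ C₀ ∧ ∀ t : ℝ, 1 ≤ t →
      |idealCountError K t| ≤ C₀ * t ^ (1 - 1 / (Module.finrank ℚ K : ℝ)) := by
  obtain ⟨C, hC⟩ := h
  refine ⟨C, ?_, fun t ht ↦ hC t ht⟩
  have := (abs_nonneg _).trans (hC 1 le_rfl)
  simpa using this

variable {K} in
/-- `E_K(t) = O(t^{1 − 1/d})` at `+∞`, in the form needed by the Mellin machinery. [folklore] -/
theorem isBigO_idealCountErrorC_atTop (h : idealCount_sub_residue_mul_le K) :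
    idealCountErrorC K =O[atTop] fun t : ℝ ↦ t ^ (-(1 / (Module.finrank ℚ K : ℝ) - 1)) := by
  obtain ⟨C₀, hC₀, hE⟩ := exists_bound_idealCountError h
  refine IsBigO.of_bound C₀ ?_
  filter_upwards [eventually_ge_atTop (1 : ℝ)] with t ht
  have ht0 : 0 < t := by linarith
  rw [Real.norm_of_nonneg (Real.rpow_nonneg ht0.le _),
    show -(1 / (Module.finrank ℚ K : ℝ) - 1) = 1 - 1 / (Module.finrank ℚ K : ℝ) by ring]
  unfold idealCountErrorC
  rcases em (t ∈ Set.Ioi (1 : ℝ)) with h1 | h1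
  · rw [Set.indicator_of_mem h1, Complex.norm_real, Real.norm_eq_abs]
    exact hE t ht
  · rw [Set.indicator_of_notMem h1, norm_zero]
    positivity

variable {K} in
/-- The Mellin transform `s ↦ ∫₁^∞ E_K(t) t^{−s−1} dt` is holomorphic on `σ > 1 − 1/d`
(Mathlib's `mellin_differentiableAt_of_isBigO_rpow`). [folklore] -/
theorem differentiableAt_mellin_idealCountErrorC (h : idealCount_sub_residue_mul_le K) {s : ℂ}
    (hs : s ∈ landauHalfPlane K) :
    DifferentiableAt ℂ (fun z ↦ mellin (idealCountErrorC K) (-z)) s := by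
  simp only [landauHalfPlane, Set.mem_setOf_eq] at hs
  have hd : DifferentiableAt ℂ (mellin (idealCountErrorC K)) (-s) := by
    refine mellin_differentiableAt_of_isBigO_rpow (a := 1 / (Module.finrank ℚ K : ℝ) - 1)
      (b := -s.re - 1) ((locallyIntegrable_idealCountErrorC K).locallyIntegrableOn _)
      (isBigO_idealCountErrorC_atTop h) ?_ (isBigO_idealCountErrorC_nhdsGT_zero K _) ?_
    · simp only [neg_re]; linarith
    · simp only [neg_re]; linarith
  exact hd.comp s (differentiable_neg s)

variable {K} in
/-- `G` is holomorphic on Landau's half-plane. [folklore] -/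
theorem differentiableOn_landauG (h : idealCount_sub_residue_mul_le K) :
    DifferentiableOn ℂ (landauG K) (landauHalfPlane K) := by
  intro s hs
  have hm := differentiableAt_mellin_idealCountErrorC h hs
  have : landauG K = fun z ↦ (NumberField.dedekindZeta_residue K : ℂ) * z +
      z * (z - 1) * mellin (idealCountErrorC K) (-z) := rfl
  rw [this]
  exact (((differentiableAt_const _).mul differentiableAt_id).add
    ((differentiableAt_id.mul (differentiableAt_id.sub (differentiableAt_const _))).mul
      hm)).differentiableWithinAt

variable {K} in
/-- Pointwise bound `‖t^{−s−1} E_K(t)‖ ≤ C₀ t^{−(σ + 1/d)}` for `t > 1`. [folklore] -/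
theorem norm_cpow_mul_idealCountError_le {C₀ : ℝ}
    (hE : ∀ t : ℝ, 1 ≤ t → |idealCountError K t| ≤ C₀ * t ^ (1 - 1 / (Module.finrank ℚ K : ℝ)))
    (s : ℂ) {t : ℝ} (ht : 1 < t) :
    ‖(t : ℂ) ^ (-s - 1) * (idealCountError K t : ℂ)‖ ≤
      C₀ * t ^ (-(s.re + 1 / (Module.finrank ℚ K : ℝ))) := by
  have ht0 : 0 < t := zero_lt_one.trans ht
  rw [norm_mul, norm_cpow_eq_rpow_re_of_pos ht0, Complex.norm_real, Real.norm_eq_abs]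
  have hre : (-s - 1).re = -s.re - 1 := by simp
  rw [hre]
  calc t ^ (-s.re - 1) * |idealCountError K t|
      ≤ t ^ (-s.re - 1) * (C₀ * t ^ (1 - 1 / (Module.finrank ℚ K : ℝ))) :=
        mul_le_mul_of_nonneg_left (hE t ht.le) (Real.rpow_nonneg ht0.le _)
    _ = C₀ * (t ^ (-s.re - 1) * t ^ (1 - 1 / (Module.finrank ℚ K : ℝ))) := by ring
    _ = C₀ * t ^ (-(s.re + 1 / (Module.finrank ℚ K : ℝ))) := by
        rw [← Real.rpow_add ht0]
        ring_nf

variable {K} in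
/-- `t ↦ t^{−s−1} E_K(t)` is integrable on `(1, ∞)` for `σ > 1 − 1/d`. [folklore] -/
theorem integrableOn_cpow_mul_idealCountError (h : idealCount_sub_residue_mul_le K) {s : ℂ}
    (hs : 1 - 1 / (Module.finrank ℚ K : ℝ) < s.re) :
    IntegrableOn (fun t : ℝ ↦ (t : ℂ) ^ (-s - 1) * (idealCountError K t : ℂ)) (Set.Ioi 1) := by
  obtain ⟨C₀, hC₀, hE⟩ := exists_bound_idealCountError h
  have hexp : -(s.re + 1 / (Module.finrank ℚ K : ℝ)) < -1 := by linarith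
  refine Integrable.mono' ((integrableOn_Ioi_rpow_of_lt hexp zero_lt_one).const_mul C₀) ?_ ?_
  · refine (ContinuousOn.aestronglyMeasurable ?_ measurableSet_Ioi).mul
      (Complex.measurable_ofReal.comp (measurable_idealCountError K)).aestronglyMeasurable
    exact fun t ht ↦ (continuousAt_ofReal_cpow_const t _
      (Or.inr (zero_lt_one.trans ht).ne')).continuousWithinAt
  · exact ae_restrict_of_forall_mem measurableSet_Ioi fun t ht ↦
      norm_cpow_mul_idealCountError_le hE s ht

variable {K} in
/-- The bound `‖∫₁^∞ E_K(t) t^{−s−1} dt‖ ≤ C₀ / (σ − 1 + 1/d)` for `σ > 1 − 1/d`. [folklore] -/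
theorem norm_mellin_idealCountErrorC_le (h : idealCount_sub_residue_mul_le K) :
    ∃ C₀ : ℝ, 0 ≤ C₀ ∧ ∀ s : ℂ, 1 - 1 / (Module.finrank ℚ K : ℝ) < s.re →
      ‖mellin (idealCountErrorC K) (-s)‖ ≤ C₀ / (s.re - 1 + 1 / (Module.finrank ℚ K : ℝ)) := by
  obtain ⟨C₀, hC₀, hE⟩ := exists_bound_idealCountError h
  refine ⟨C₀, hC₀, fun s hs ↦ ?_⟩
  rw [mellin_idealCountErrorC]
  have hexp : -(s.re + 1 / (Module.finrank ℚ K : ℝ)) < -1 := by linarith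
  have hne : -(s.re + 1 / (Module.finrank ℚ K : ℝ)) + 1 ≠ 0 := by linarith
  calc ‖∫ t in Set.Ioi (1 : ℝ), (t : ℂ) ^ (-s - 1) * (idealCountError K t : ℂ)‖
      ≤ ∫ t in Set.Ioi (1 : ℝ), C₀ * t ^ (-(s.re + 1 / (Module.finrank ℚ K : ℝ))) :=
        norm_integral_le_of_norm_le ((integrableOn_Ioi_rpow_of_lt hexp zero_lt_one).const_mul C₀)
          (ae_restrict_of_forall_mem measurableSet_Ioi fun t ht ↦
            norm_cpow_mul_idealCountError_le hE s ht)
    _ = C₀ * (-(1 : ℝ) ^ (-(s.re + 1 / (Module.finrank ℚ K : ℝ)) + 1) /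
          (-(s.re + 1 / (Module.finrank ℚ K : ℝ)) + 1)) := by
        rw [integral_const_mul, integral_Ioi_rpow_of_lt hexp zero_lt_one]
    _ = C₀ / (s.re - 1 + 1 / (Module.finrank ℚ K : ℝ)) := by
        have hu : -(s.re + 1 / (Module.finrank ℚ K : ℝ)) + 1 =
            -(s.re - 1 + 1 / (Module.finrank ℚ K : ℝ)) := by ring
        rw [Real.one_rpow, hu, neg_div_neg_eq, mul_one_div]

variable {K} in
/-- **`G(s) = (s − 1) ζ_K(s)` for `σ > 1`** (partial summation, MV Theorem 1.3 / (1.24) for `ζ_K`: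
`ζ_K(s) = s ∫₁^∞ I_K(t) t^{−s−1} dt = ρ_K s/(s−1) + s ∫₁^∞ E_K(t) t^{−s−1} dt`).
[cite: MontgomeryVaughan2007, p. 267] -/
theorem landauG_eq_mul (h : idealCount_sub_residue_mul_le K) {s : ℂ} (hs : 1 < s.re) :
    landauG K s = (s - 1) * NumberField.dedekindZeta K s := by
  obtain ⟨C₀, hC₀, hE⟩ := exists_bound_idealCountError h
  set ρ : ℝ := NumberField.dedekindZeta_residue K with hρ
  have hs1 : s - 1 ≠ 0 := by
    intro h1
    have := congrArg re h1
    simp at this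
    linarith
  have hs1' : -s + 1 ≠ 0 := by
    intro h1
    apply hs1
    linear_combination -h1
  -- Step 1: the integral representation of the Dirichlet series
  set a : ℕ → ℂ := fun n ↦ (Nat.card {I : Ideal (𝓞 K) // Ideal.absNorm I = n} : ℂ) with ha
  have hζ : NumberField.dedekindZeta K s = LSeries a s := rfl
  have hsum : ∀ n : ℕ, ∑ k ∈ Icc 1 n, a k = (idealCount K n : ℂ) := fun n ↦ by
    rw [idealCount_natCast_eq_sum]
    push_cast
    rfl
  have hnorm : ∀ n : ℕ, ∑ k ∈ Icc 1 n, ‖a k‖ = (idealCount K n : ℝ) := fun n ↦ by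
    simp only [a, Complex.norm_natCast]
    rw [idealCount_natCast_eq_sum]
    push_cast
    rfl
  have hO : (fun n : ℕ ↦ ∑ k ∈ Icc 1 n, ‖a k‖) =O[atTop] fun n ↦ (n : ℝ) ^ (1 : ℝ) := by
    refine IsBigO.of_bound (ρ + C₀) ?_
    filter_upwards [eventually_ge_atTop 1] with n hn
    have hn' : (1 : ℝ) ≤ n := by exact_mod_cast hn
    rw [hnorm, Real.norm_of_nonneg (Nat.cast_nonneg _), Real.rpow_one,
      Real.norm_of_nonneg (by positivity)]
    have h1 := hE n hn'
    have h2 : (n : ℝ) ^ (1 - 1 / (Module.finrank ℚ K : ℝ)) ≤ n := by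
      conv_rhs => rw [← Real.rpow_one (n : ℝ)]
      refine Real.rpow_le_rpow_of_exponent_le hn' ?_
      have : (0 : ℝ) ≤ 1 / (Module.finrank ℚ K : ℝ) := by positivity
      linarith
    rw [idealCountError] at h1
    have h3 := (abs_le.mp h1).2
    nlinarith
  have hL := LSeries_eq_mul_integral' a zero_le_one (by simpa using hs) hO
  -- Step 2: rewrite the integrand on `(1, ∞)`
  have hint_eq : ∫ t in Set.Ioi (1 : ℝ), (∑ k ∈ Icc 1 ⌊t⌋₊, a k) * (t : ℂ) ^ (-(s + 1)) =
      ∫ t in Set.Ioi (1 : ℝ),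
        ((ρ : ℂ) * (t : ℂ) ^ (-s) + (t : ℂ) ^ (-s - 1) * (idealCountError K t : ℂ)) := by
    refine setIntegral_congr_fun measurableSet_Ioi fun t ht ↦ ?_
    have ht0 : (0 : ℝ) < t := zero_lt_one.trans ht
    have ht0' : (t : ℂ) ≠ 0 := ofReal_ne_zero.mpr ht0.ne'
    rw [hsum, ← idealCount_eq_idealCount_floor K ht0.le]
    have hI : (idealCount K t : ℂ) = ρ * t + (idealCountError K t : ℂ) := by
      simp only [idealCountError, Complex.ofReal_sub, Complex.ofReal_mul, Complex.ofReal_natCast]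
      ring
    have hpow : (t : ℂ) ^ (-(s + 1)) = (t : ℂ) ^ (-s - 1) := by ring_nf
    have hpow2 : (t : ℂ) ^ (-s) = (t : ℂ) ^ (-s - 1) * (t : ℂ) := by
      conv_lhs => rw [show (-s : ℂ) = (-s - 1) + 1 by ring]
      rw [cpow_add _ _ ht0', cpow_one]
    rw [hI, hpow, hpow2]
    ring
  -- Step 3: split the integral and evaluate `∫₁^∞ t^{-s} dt = 1/(s-1)`
  have hi1 : IntegrableOn (fun t : ℝ ↦ (ρ : ℂ) * (t : ℂ) ^ (-s)) (Set.Ioi 1) :=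
    (integrableOn_Ioi_cpow_of_lt (by simpa using hs : (-s).re < -1) zero_lt_one).const_mul _
  have hd0 : (0 : ℝ) ≤ 1 / (Module.finrank ℚ K : ℝ) := by positivity
  have hi2 := integrableOn_cpow_mul_idealCountError h (s := s) (by linarith)
  have hcpow : ∫ t in Set.Ioi (1 : ℝ), (t : ℂ) ^ (-s) = -1 / (-s + 1) := by
    rw [integral_Ioi_cpow_of_lt (by simpa using hs : (-s).re < -1) zero_lt_one, ofReal_one,
      one_cpow]
  rw [hζ, hL, hint_eq, integral_add hi1 hi2, integral_const_mul, hcpow,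
    ← mellin_idealCountErrorC, landauG]
  field_simp
  ring

variable {K} in
/-- **Growth**: `‖G(s)/(s − 1)‖ ≤ C_δ |t|` for `σ ≥ 1 − 1/d + δ`, `|t| ≥ 1` (MV p. 267:
`ζ_K(s) ≪ |t|`). [cite: MontgomeryVaughan2007, p. 267] -/
theorem norm_landauG_div_le (h : idealCount_sub_residue_mul_le K) {δ : ℝ} (hδ : 0 < δ) :
    ∃ C : ℝ, ∀ s : ℂ, 1 - 1 / (Module.finrank ℚ K : ℝ) + δ ≤ s.re → 1 ≤ |s.im| →
      ‖landauG K s / (s - 1)‖ ≤ C * |s.im| := by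
  obtain ⟨C₀, hC₀, hM⟩ := norm_mellin_idealCountErrorC_le h
  set ρ : ℝ := NumberField.dedekindZeta_residue K with hρ
  have hρ0 : 0 ≤ ρ := (NumberField.dedekindZeta_residue_pos K).le
  refine ⟨2 * ρ + C₀ * (1 + 2 / δ), fun s hσ ht ↦ ?_⟩
  have hd1 : 1 / (Module.finrank ℚ K : ℝ) ≤ 1 := by
    rw [div_le_one (by exact_mod_cast Module.finrank_pos)]
    exact_mod_cast Module.finrank_pos
  have hd0 : (0 : ℝ) ≤ 1 / (Module.finrank ℚ K : ℝ) := by positivity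
  set u : ℝ := s.re - 1 + 1 / (Module.finrank ℚ K : ℝ) with hu
  have hδu : δ ≤ u := by linarith
  have hu0 : 0 < u := hδ.trans_le hδu
  have hσu : s.re ≤ u + 1 := by linarith
  have hσ0 : 0 < s.re := by linarith
  have hs1 : s - 1 ≠ 0 := by
    intro h0
    have := congrArg im h0
    simp at this
    rw [this] at ht
    norm_num at ht
  -- `G/(s-1) = ρ s/(s-1) + s M`
  have hG : landauG K s / (s - 1) =
      (ρ : ℂ) * (s / (s - 1)) + s * mellin (idealCountErrorC K) (-s) := by
    unfold landauG
    rw [← hρ]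
    field_simp
  rw [hG]
  -- `‖s/(s-1)‖ ≤ 2`
  have hn0 : 1 ≤ ‖s - 1‖ := ht.trans (by simpa using abs_im_le_norm (s - 1))
  have hn1 : ‖s / (s - 1)‖ ≤ 2 := by
    rw [norm_div, div_le_iff₀ (by linarith)]
    have : ‖s‖ ≤ ‖s - 1‖ + 1 := by
      calc ‖s‖ = ‖(s - 1) + 1‖ := by ring_nf
        _ ≤ ‖s - 1‖ + ‖(1 : ℂ)‖ := norm_add_le _ _
        _ = ‖s - 1‖ + 1 := by rw [norm_one]
    linarith
  -- `‖s‖ ≤ σ + |t|`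
  have hn2 : ‖s‖ ≤ s.re + |s.im| := by
    have := norm_le_abs_re_add_abs_im s
    rwa [abs_of_pos hσ0] at this
  have hM' := hM s (by linarith)
  -- the real inequality `(σ + |t|) C₀ / u ≤ C₀ (1 + 2/δ) |t|`
  have hkey : (s.re + |s.im|) * (C₀ / u) ≤ C₀ * (1 + 2 / δ) * |s.im| := by
    have h1 : (s.re + |s.im|) / u ≤ (1 + 2 / δ) * |s.im| := by
      calc (s.re + |s.im|) / u ≤ (u + 1 + |s.im|) / u :=
            div_le_div_of_nonneg_right (by linarith) hu0.le
        _ = 1 + (1 + |s.im|) / u := by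
            field_simp
            ring
        _ ≤ 1 + (1 + |s.im|) / δ := by
            have := div_le_div_of_nonneg_left (by positivity : 0 ≤ 1 + |s.im|) hδ hδu
            linarith
        _ ≤ (1 + 2 / δ) * |s.im| := by
            have h2 : 1 / δ ≤ |s.im| / δ := div_le_div_of_nonneg_right ht hδ.le
            have h5 : (1 + 2 / δ) * |s.im| = |s.im| + (|s.im| / δ + |s.im| / δ) := by ring
            have h6 : (1 + |s.im|) / δ = 1 / δ + |s.im| / δ := by ring
            rw [h5, h6]
            linarith
    calc (s.re + |s.im|) * (C₀ / u) = C₀ * ((s.re + |s.im|) / u) := by ring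
      _ ≤ C₀ * ((1 + 2 / δ) * |s.im|) := mul_le_mul_of_nonneg_left h1 hC₀
      _ = C₀ * (1 + 2 / δ) * |s.im| := by ring
  calc ‖(ρ : ℂ) * (s / (s - 1)) + s * mellin (idealCountErrorC K) (-s)‖
      ≤ ‖(ρ : ℂ) * (s / (s - 1))‖ + ‖s * mellin (idealCountErrorC K) (-s)‖ := norm_add_le _ _
    _ ≤ ρ * 2 + (s.re + |s.im|) * (C₀ / u) := by
        rw [norm_mul, norm_mul, Complex.norm_real, Real.norm_of_nonneg hρ0]
        exact add_le_add (mul_le_mul_of_nonneg_left hn1 hρ0)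
          (mul_le_mul hn2 hM' (norm_nonneg _) (by positivity))
    _ ≤ ρ * 2 * |s.im| + C₀ * (1 + 2 / δ) * |s.im| := by
        refine add_le_add ?_ hkey
        exact le_mul_of_one_le_right (by positivity) ht
    _ = (2 * ρ + C₀ * (1 + 2 / δ)) * |s.im| := by ring

/-- **Landau's continuation from the ideal-counting error term**: the named fact
`idealCount_sub_residue_mul_le K` (`I_K(x) = ρ_K x + O(x^{1−1/d})`, MV (8.43)) implies the named
fact `exists_isLandauContinuation K` (`ζ_K` continues to `σ > 1 − 1/d` with a simple pole of
residue `ρ_K` at `1` and `ζ_K(s) ≪_δ |t|`; Landau 1903 p. 666 property 1), MV p. 267), with the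
explicit witness `landauG K`. [cite: MontgomeryVaughan2007, p. 267] -/
theorem exists_isLandauContinuation_of_idealCount (h : idealCount_sub_residue_mul_le K) :
    exists_isLandauContinuation K :=
  ⟨landauG K, ⟨differentiableOn_landauG h, fun _ hs ↦ landauG_eq_mul h hs⟩, landauG_one K,
    fun _ hδ ↦ norm_landauG_div_le h hδ⟩

end Literature.NumberTheory.LFunctions.NumberField

end
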